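import Literature.AlgebraicGeometry.DuqueFrancoVillaflor2023.FakeLinearCycleRationalPeriods
import HarnessLib

/-!
# Fake linear cycles are rational combinations of linear cycles with the same pairing — algebraic core
(Duque Franco–Villaflor, *Periods of join algebraic cycles*, Remark 7.1 / Theorem 7.1)

Certified instances and evidence bearing on the general Hodge conjecture; no claim.

J. Duque Franco, R. Villaflor Loyola, *Periods of join algebraic cycles*, Ann. Sc. Norm. Super. Pisa Cl. Sci. (2025),
arXiv:2312.17222 [DuqueFrancoVillaflor2025Join], §7 "Fake algebraic cycles" (held text pp. 18–19):

> **Remark 7.1.** By [DuqueVillaflor] all Fermat varieties of degree `d = 3,4,6` (and only for those degrees) admit fake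
> linear cycles. […] `P_λ = c_λ ∏_{j=0}^{n/2} (x_{2j}^{d−1} − (c_j x_{2j+1})^{d−1})/(x_{2j} − c_j x_{2j+1})` […]
> `R^{F,λ} = ⊗_j R^{F_j,λ_j}` where `X_j = {x_{2j−2}^d + x_{2j−1}^d = 0} ⊆ ℙ¹` and `λ_j` is the class of a `0`-cycle such
> that `P_{λ_j} = (x_{2j−2}^{d−1} − (c_{2j−2}x_{2j−1})^{d−1})/(x_{2j−2} − c_{2j−2}x_{2j−1})`. In other words, each `λ_j` is a
> `0`-dimensional fake linear cycle. Since this is a Hodge cycle, there exist `n_{j,1}, …, n_{j,d} ∈ ℚ` such that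
> `P_{λ_j} = Σ_{ℓ=1}^d n_{j,ℓ}·P_{[p^j_ℓ]}` where `X_j = {p^j_1, …, p^j_d} ⊆ ℙ¹` (note that each `p^j_ℓ ∈ CH⁰(X_j)` is a
> linear cycle, and so we know how to compute `P_{[p^j_ℓ]}`). It follows from Theorem 1.2 that
> `λ_prim = c·J(λ_1, λ_2, …, λ_{n/2+1})` for some `c ∈ ℚ^×`. In other words, **every fake linear cycle is a linear
> combination of linear cycles given by `λ = Σ_{ℓ_1,…,ℓ_{n/2+1}=1}^d (∏_j n_{j,ℓ_j})·J(p^1_{ℓ_1}, p^2_{ℓ_2}, …, p^{n/2+1}_{ℓ_{n/2+1}})`.**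

> Proof of **Theorem 7.1** (p. 19): "Since all the points `[p_1]_prim, …, [p_d]_prim` generate the `ℚ`-vector space
> `H⁰(X,ℚ)_prim` of dimension `d−1`, and the residue map is an isomorphism of `ℂ[x_0,x_1]_{d−2} = R^F_{d−2} ≃ H⁰(X,ℂ)_prim`,
> it follows that the polynomials `P_1, …, P_d` generate all `ℚ[x_0,x_1]_{d−2}` as `ℚ`-vector space."

The polynomial of the point `p_ℓ = (t_ℓ : 1)` of the `0`-dimensional Fermat variety `{x^d + y^d = 0}` (`t_ℓ^d = −1`,
`t_ℓ = ζ^{2ℓ+1}` for a primitive `2d`-th root `ζ`) is, with the rational constant `c_δ` dropped as everywhere in the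
tree, `t_ℓ · Σ_{i<d−1} x^i (t_ℓ y)^{d−2−i}` ([Villaflorloyola2021] Prop. 5.2; tree `fermatLinearCycleFactor`,
`Villaflor2022.linearCyclePoly`).

## What this file PROVES (0 facts, 0 sorry), `K` a field of characteristic `0` with a primitive `2d`-th root `ζ`

* `sum_pow_oddPow` — the power sums over the `d`-th roots of `−1`: `Σ_{r<d} (ζ^{2r+1})^m = d·(−1)^{m/d}` if `d ∣ m`,
  and `0` otherwise.
* `pow_eq_sum_interpolation` / **`fermatLinearCycleFactor_eq_sum`** — the INTERPOLATION IDENTITY behind "the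
  polynomials `P_1, …, P_d` generate `ℚ[x_0,x_1]_{d−2}`", explicit and valid for EVERY twist `a ∈ K` and every
  parameter `M ∈ K`: `Σ_i x^i (a y)^{d−2−i} = Σ_{r<d} μ_r · Σ_i x^i (t_r y)^{d−2−i}` with
  `μ_r = t_r (M − T(t_r))/d`, `T(t) = pairPeriod d a t = t Σ_i a^i t^{d−2−i}` (the period of the `0`-dimensional
  factor over the point `p_r`); proof: the power sums kill every term except `i + l = d − 2`.
* **`fermatLinearCycleFactor_eq_ratCombination`** (Remark 7.1, one factor: "there exist `n_{j,1}, …, n_{j,d} ∈ ℚ` such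
  that `P_{λ_j} = Σ_ℓ n_{j,ℓ} P_{[p^j_ℓ]}`"): if the twist `a` satisfies Villaflor's (arthcond1) — the ratios
  `T(y)/T(x)` of its periods over the `d`-th roots of `−1` are rational, which is the case for the twists
  `ζ_{2d}^{−3}·𝕊¹_{ℚ(ζ_d)}` of fake linear cycles ([Villaflorloyola2021] §6) and is the per-twist conclusion of the
  tree's `Villaflor2022.exists_fakeLinearCycle_of_rational_periods` — then, choosing `M = T(s₀) ≠ 0`,
  `Σ_i x^i (a y)^{d−2−i} = (T(s₀)/d) · Σ_r n_r · (t_r Σ_i x^i (t_r y)^{d−2−i})` with `n_r = 1 − T(t_r)/T(s₀) ∈ ℚ`.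
* **`fermatLinearCyclePolynomial_eq_ratCombination`** (Remark 7.1, the displayed conclusion "every fake linear cycle
  is a linear combination of linear cycles `λ = Σ (∏_j n_{j,ℓ_j})·J(p^1_{ℓ_1}, …)`", at the level of the polynomials
  `P_λ/c_λ`): for twists `a_j` all satisfying (arthcond1),
  `∏_j Σ_i x_{j,0}^i (a_j x_{j,1})^{d−2−i} = c₀ · Σ_{R : j ↦ r_j} q_R · ((∏_j t_{R j}) · ∏_j Σ_i x_{j,0}^i (t_{R j} x_{j,1})^{d−2−i})`
  with `q_R = ∏_j n_{j,R j} ∈ ℚ` and `c₀ ∈ K` — a `K^×`-multiple of a RATIONAL combination of the normalised polynomials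
  `(∏ t)·P_t` (tree `fermatLinearCyclePolynomial`, `linearCyclePoly`) of the `d^{n/2+1}` GENUINE linear cycles with the
  same pairing (the joins `J(p^1_{ℓ_1}, …, p^{n/2+1}_{ℓ_{n/2+1}})`).
* `exists_ratCombination_of_ratio_rational` — the witness-free form: (arthcond1) for every twist (ratios `T_j(y)/T_j(x)`
  rational whenever `T_j(x) ≠ 0`) gives `∏_j (…) = c₀ · Σ_R q_R · ((∏ t)·P_t)` with `c₀ ≠ 0`, `q_R ∈ ℚ`
  (the witnesses `s₀(j)` come from `Villaflor2022.exists_pairPeriod_ne_zero`).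
* **`fakeLinearCyclePolynomial_eq_ratCombination`** — Remark 7.1 for the fake linear cycles of [DuquefrancoVillaflorloyola2023]
  (`d = 3, 4, 6`, twists in `DuqueFrancoVillaflor2023.IsFakeTwist` = `ζ_{2d}^{−3}·𝕊¹_{ℚ(ζ_d)}`): unconditional,
  (arthcond1) being supplied by `DuqueFrancoVillaflor2023.fake_pairPeriod_ratio_rational`;
  `rename_fakeLinearCyclePolynomial_eq_ratCombination`: the same in the coordinates of `ℙ^{n+1}` (pairing `θ`), over
  the tree's `Villaflor2022.linearCyclePoly`.

The transcendental dictionary (`P ↦ res(PΩ/F^{n/2+1})`, "Since this is a Hodge cycle") is not formalised; the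
rationality input is exactly Villaflor's per-twist condition (arthcond1), as in the tree's formalisation of
[Villaflorloyola2021] Thm. 1.2. References: [DuqueFrancoVillaflor2025Join] Rem. 7.1, Thm. 7.1 (proof), Thm. 1.2;
[Villaflorloyola2021] Prop. 5.2, §6; [DuquefrancoVillaflorloyola2023] Thm. 1.1.
-/

noncomputable section

open MvPolynomial Finset Literature.AlgebraicGeometry.HodgeTheory Literature.AlgebraicGeometry.Villaflor2022
  Literature.AlgebraicGeometry.DuqueFrancoVillaflor2023

namespace Literature.AlgebraicGeometry.DuqueFrancoVillaflor2025

variable {K : Type*} [Field K]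

/-! ## Power sums over the `d`-th roots of `−1` -/

/-- **Power sums over the points of the `0`-dimensional Fermat variety.** For `ζ` a primitive `2d`-th root of unity
the `d`-th roots of `−1` are `t_r = ζ^{2r+1}`, `r < d`, and `Σ_{r<d} t_r^m = d·(−1)^{m/d}` if `d ∣ m`, `0` otherwise
(`Σ_r (ζ^{2m})^r` is a geometric sum). [cite: DuqueFrancoVillaflor2025Join, Theorem 7.1 (proof)] -/
theorem sum_pow_oddPow {d : ℕ} (hd : 0 < d) {ζ : K} (hζ : IsPrimitiveRoot ζ (2 * d)) (m : ℕ) :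
    ∑ r ∈ range d, (ζ ^ (2 * r + 1)) ^ m = if d ∣ m then (d : K) * (-1) ^ (m / d) else 0 := by
  have hζd : ζ ^ d = -1 := pow_eq_neg_one_of_isPrimitiveRoot_two_mul hd hζ
  have hterm : ∀ r, (ζ ^ (2 * r + 1)) ^ m = ζ ^ m * (ζ ^ (2 * m)) ^ r := fun r => by
    rw [← pow_mul, ← pow_mul, ← pow_add]
    ring_nf
  rw [Finset.sum_congr rfl fun r _ => hterm r, ← Finset.mul_sum]
  split_ifs with hdm
  · obtain ⟨q, rfl⟩ := hdm
    have hw : ζ ^ (2 * (d * q)) = 1 := by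
      rw [show 2 * (d * q) = (2 * d) * q by ring, pow_mul, hζ.pow_eq_one, one_pow]
    rw [hw, Finset.sum_congr rfl fun r _ => one_pow r, Finset.sum_const, Finset.card_range, nsmul_eq_mul, mul_one,
      pow_mul, hζd, Nat.mul_div_cancel_left q hd, mul_comm]
  · have hw1 : ζ ^ (2 * m) ≠ 1 := by
      rw [Ne, hζ.pow_eq_one_iff_dvd]
      rintro ⟨q, hq⟩
      exact hdm ⟨q, by rw [mul_assoc] at hq; omega⟩
    have hwd : (ζ ^ (2 * m)) ^ d = 1 := by
      rw [← pow_mul, show 2 * m * d = (2 * d) * m by ring, pow_mul, hζ.pow_eq_one, one_pow]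
    have hgeom : (∑ r ∈ range d, (ζ ^ (2 * m)) ^ r) * (ζ ^ (2 * m) - 1) = 0 := by
      rw [geom_sum_mul, hwd, sub_self]
    rcases mul_eq_zero.mp hgeom with h | h
    · rw [h, mul_zero]
    · exact absurd (sub_eq_zero.mp h) hw1

/-! ## The interpolation identity -/

/-- **The scalar interpolation identity.** For every `a, M ∈ K` and `l ≤ d − 2` (`d ≥ 2`):
`a^{d−2−l} = Σ_{r<d} (t_r (M − T(t_r))/d) · t_r^{d−2−l}`, `t_r = ζ^{2r+1}`, `T = pairPeriod d a`
(`T(t) = Σ_i a^i t^{d−1−i}`): the power sums over the `t_r` kill `M·t^{d−1−l}` (`1 ≤ d−1−l ≤ d−1`) and every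
`a^i t^{2d−2−i−l}` except `i = d−2−l`, which contributes `−d·a^{d−2−l}`.
[cite: DuqueFrancoVillaflor2025Join, Theorem 7.1 (proof), Remark 7.1] -/
theorem pow_eq_sum_interpolation [CharZero K] {d : ℕ} (hd : 2 ≤ d) {ζ : K} (hζ : IsPrimitiveRoot ζ (2 * d))
    (a M : K) {l : ℕ} (hl : l ≤ d - 2) :
    a ^ (d - 2 - l) = ∑ r ∈ range d,
      ζ ^ (2 * r + 1) * (M - pairPeriod d a (ζ ^ (2 * r + 1))) / d * (ζ ^ (2 * r + 1)) ^ (d - 2 - l) := by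
  have hd0 : 0 < d := by omega
  have hdK : (d : K) ≠ 0 := Nat.cast_ne_zero.mpr (by omega)
  -- expand the summand: `(M t^{d−1−l} − Σ_i a^i t^{2d−2−i−l}) / d`
  have hexp : ∀ r, ζ ^ (2 * r + 1) * (M - pairPeriod d a (ζ ^ (2 * r + 1))) / d * (ζ ^ (2 * r + 1)) ^ (d - 2 - l) =
      (M * (ζ ^ (2 * r + 1)) ^ (d - 1 - l) -
        ∑ i ∈ range (d - 1), a ^ i * (ζ ^ (2 * r + 1)) ^ (2 * d - 2 - i - l)) / d := by
    intro r
    set t := ζ ^ (2 * r + 1) with ht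
    have h1 : t * t ^ (d - 2 - l) = t ^ (d - 1 - l) := by
      rw [← pow_succ', show d - 2 - l + 1 = d - 1 - l by omega]
    have h2 : pairPeriod d a t * (t * t ^ (d - 2 - l)) = ∑ i ∈ range (d - 1), a ^ i * t ^ (2 * d - 2 - i - l) := by
      rw [pairPeriod, pairSum, Finset.mul_sum, Finset.sum_mul]
      refine Finset.sum_congr rfl fun i hi => ?_
      rw [Finset.mem_range] at hi
      rw [h1, show t * (a ^ i * t ^ (d - 1 - 1 - i)) * t ^ (d - 1 - l) =
        a ^ i * (t * t ^ (d - 1 - 1 - i) * t ^ (d - 1 - l)) by ring, ← pow_succ', ← pow_add,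
        show d - 1 - 1 - i + 1 + (d - 1 - l) = 2 * d - 2 - i - l by omega]
    rw [div_mul_eq_mul_div]
    congr 1
    rw [← h2, ← h1]
    ring
  rw [Finset.sum_congr rfl fun r _ => hexp r, ← Finset.sum_div, Finset.sum_sub_distrib, ← Finset.mul_sum,
    Finset.sum_comm]
  -- the power sums
  have hS1 : ∑ r ∈ range d, (ζ ^ (2 * r + 1)) ^ (d - 1 - l) = 0 := by
    rw [sum_pow_oddPow hd0 hζ, if_neg]
    intro h
    have := Nat.le_of_dvd (by omega) h
    omega
  have hS2 : ∀ i ∈ range (d - 1), ∑ r ∈ range d, a ^ i * (ζ ^ (2 * r + 1)) ^ (2 * d - 2 - i - l) =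
      if i = d - 2 - l then -(d : K) * a ^ (d - 2 - l) else 0 := by
    intro i hi
    rw [Finset.mem_range] at hi
    rw [← Finset.mul_sum, sum_pow_oddPow hd0 hζ]
    by_cases h : i = d - 2 - l
    · subst h
      have hm : 2 * d - 2 - (d - 2 - l) - l = d := by omega
      rw [if_pos ⟨1, by rw [hm, mul_one]⟩, if_pos rfl, hm, Nat.div_self hd0, pow_one]
      ring
    · rw [if_neg, if_neg h, mul_zero]
      intro hdvd
      obtain ⟨q, hq⟩ := hdvd
      have hq1 : q = 1 := by
        rcases Nat.lt_or_ge q 2 with hq2 | hq2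
        · interval_cases q
          · omega
          · rfl
        · have : d * 2 ≤ d * q := Nat.mul_le_mul_left d hq2
          omega
      subst hq1
      omega
  rw [hS1, mul_zero, Finset.sum_congr rfl hS2, Finset.sum_ite_eq' (range (d - 1)) (d - 2 - l),
    if_pos (Finset.mem_range.mpr (by omega))]
  field_simp
  ring

/-- The `0`-dimensional factor as an explicit sum of monomials: `Σ_{i<e} c^{e−1−i}·x^i y^{e−1−i}`.
[cite: DuqueFrancoVillaflor2025Join, Remark 7.1] -/
theorem fermatLinearCycleFactor_eq_sum_C_mul {τ : Type*} (c : τ → K) (e : ℕ) (j : τ) :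
    fermatLinearCycleFactor c e j = ∑ i ∈ range e,
      C (c j ^ (e - 1 - i)) * ((X (Sum.inl j) : MvPolynomial (τ ⊕ τ) K) ^ i * X (Sum.inr j) ^ (e - 1 - i)) := by
  rw [fermatLinearCycleFactor]
  refine Finset.sum_congr rfl fun i _ => ?_
  rw [mul_pow, map_pow]
  ring

/-- **The interpolation identity for the `0`-dimensional factor** ("the polynomials `P_1, …, P_d` generate
`ℂ[x_0,x_1]_{d−2}`", explicitly): for EVERY twist function `a` and every `M ∈ K`,
`Σ_i x_j^i (a_j y_j)^{d−2−i} = Σ_{r<d} μ_r · Σ_i x_j^i (t_r y_j)^{d−2−i}` with `μ_r = t_r (M − pairPeriod d a_j t_r)/d`,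
`t_r = ζ^{2r+1}`. [cite: DuqueFrancoVillaflor2025Join, Theorem 7.1 (proof), Remark 7.1] -/
theorem fermatLinearCycleFactor_eq_sum [CharZero K] {τ : Type*} {d : ℕ} (hd : 2 ≤ d) {ζ : K}
    (hζ : IsPrimitiveRoot ζ (2 * d)) (a : τ → K) (M : K) (j : τ) :
    fermatLinearCycleFactor a (d - 1) j = ∑ r ∈ range d,
      C (ζ ^ (2 * r + 1) * (M - pairPeriod d (a j) (ζ ^ (2 * r + 1))) / d) *
        fermatLinearCycleFactor (fun _ : τ => ζ ^ (2 * r + 1)) (d - 1) j := by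
  rw [fermatLinearCycleFactor_eq_sum_C_mul]
  simp only [fermatLinearCycleFactor_eq_sum_C_mul, Finset.mul_sum]
  rw [Finset.sum_comm]
  refine Finset.sum_congr rfl fun i hi => ?_
  rw [Finset.mem_range] at hi
  have key := pow_eq_sum_interpolation hd hζ (a j) M (l := i) (by omega)
  rw [show d - 1 - 1 - i = d - 2 - i by omega, key, map_sum, Finset.sum_mul]
  refine Finset.sum_congr rfl fun r _ => ?_
  rw [map_mul, mul_assoc]

/-! ## Rational coefficients under (arthcond1) -/

/-- **Remark 7.1, one factor: `P_{λ_j} = Σ_ℓ n_{j,ℓ}·P_{[p^j_ℓ]}` with `n_{j,ℓ} ∈ ℚ`** (up to the scalar `c_λ`). If the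
twist `a_j` satisfies Villaflor's (arthcond1) — the ratios of its periods `T(x) = pairPeriod d a_j x` over the `d`-th roots
`x` of `−1` are rational multiples of `T(s₀)` (a root `s₀`, in applications one with `T(s₀) ≠ 0`) — then:
`Σ_i x_j^i (a_j y_j)^{d−2−i} = (T(s₀)/d) · Σ_{r<d} n_r · (t_r · Σ_i x_j^i (t_r y_j)^{d−2−i})`, `n_r = 1 − T(t_r)/T(s₀) ∈ ℚ`
— a RATIONAL combination of the normalised polynomials `t_r P_{t_r}` of the points `p_r = (t_r : 1)`.
[cite: DuqueFrancoVillaflor2025Join, Remark 7.1] [cite: Villaflorloyola2021, §6] -/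
theorem fermatLinearCycleFactor_eq_ratCombination [CharZero K] {τ : Type*} {d : ℕ} (hd : 2 ≤ d) {ζ : K}
    (hζ : IsPrimitiveRoot ζ (2 * d)) (a : τ → K) (j : τ) (s₀ : K)
    (hratio : ∀ y : K, y ^ d = -1 → ∃ q : ℚ, pairPeriod d (a j) y = (q : K) * pairPeriod d (a j) s₀) :
    ∃ n : ℕ → ℚ, fermatLinearCycleFactor a (d - 1) j = C (pairPeriod d (a j) s₀ / d) *
      ∑ r ∈ range d, (n r : K) • (C (ζ ^ (2 * r + 1)) *
        fermatLinearCycleFactor (fun _ : τ => ζ ^ (2 * r + 1)) (d - 1) j) := by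
  have hd0 : 0 < d := by omega
  have hζd : ζ ^ d = -1 := pow_eq_neg_one_of_isPrimitiveRoot_two_mul hd0 hζ
  have ht : ∀ r : ℕ, (ζ ^ (2 * r + 1)) ^ d = -1 := fun r => by
    rw [← pow_mul, show (2 * r + 1) * d = (2 * d) * r + d by ring, pow_add, pow_mul, hζ.pow_eq_one, one_pow, one_mul,
      hζd]
  choose q hq using fun r : ℕ => hratio (ζ ^ (2 * r + 1)) (ht r)
  refine ⟨fun r => 1 - q r, ?_⟩
  rw [fermatLinearCycleFactor_eq_sum hd hζ a (pairPeriod d (a j) s₀) j, Finset.mul_sum]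
  refine Finset.sum_congr rfl fun r _ => ?_
  rw [hq r, smul_eq_C_mul, ← mul_assoc, ← mul_assoc, ← map_mul, ← map_mul]
  congr 2
  push_cast
  ring

/-! ## The product: every fake linear cycle is a rational combination of linear cycles with the same pairing -/

section Product

variable [CharZero K] {τ : Type*} [Fintype τ] [DecidableEq τ]

/-- **Remark 7.1 (the displayed conclusion): "every fake linear cycle is a linear combination of linear cycles given by
`λ = Σ_{ℓ_1,…,ℓ_{n/2+1}} (∏_j n_{j,ℓ_j})·J(p^1_{ℓ_1}, …, p^{n/2+1}_{ℓ_{n/2+1}})`"** — at the level of the polynomials `P_λ/c_λ`: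
if every twist `a_j` satisfies (arthcond1) (with witnesses `s₀(j)`, `T_j(s₀(j)) ≠ 0`), then
`∏_j Σ_i x_{j,0}^i (a_j x_{j,1})^{d−2−i} = c₀ · Σ_{R : τ → [0,d)} q_R · ((∏_j t_{R j}) · P_{t∘R})` with `q_R = ∏_j n_{j,R j} ∈ ℚ`
and `c₀ = ∏_j T_j(s₀(j))/d`: a `K^×`-multiple of a RATIONAL combination of the normalised polynomials `(∏ t)·P_t`
(tree `fermatLinearCyclePolynomial`; Villaflor's `P_δ/c_δ`) of the `d^{#τ}` genuine linear cycles `{x_{j,0} = t_{R j} x_{j,1}}`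
with the same pairing — the joins of the points `p^j_{R j}`.
[cite: DuqueFrancoVillaflor2025Join, Remark 7.1, Theorem 1.2] [cite: Villaflorloyola2021, Proposition 5.2] -/
theorem fermatLinearCyclePolynomial_eq_ratCombination {d : ℕ} (hd : 2 ≤ d) {ζ : K} (hζ : IsPrimitiveRoot ζ (2 * d))
    (a : τ → K) (s₀ : τ → K)
    (hratio : ∀ j (y : K), y ^ d = -1 → ∃ q : ℚ, pairPeriod d (a j) y = (q : K) * pairPeriod d (a j) (s₀ j)) :
    ∃ q : (τ → ℕ) → ℚ, fermatLinearCyclePolynomial a (d - 1) =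
      C (∏ j, pairPeriod d (a j) (s₀ j) / d) *
        ∑ R ∈ Fintype.piFinset (fun _ : τ => range d), (q R : K) •
          (C (∏ j, ζ ^ (2 * R j + 1)) * fermatLinearCyclePolynomial (fun j => ζ ^ (2 * R j + 1)) (d - 1)) := by
  choose n hn using fun j => fermatLinearCycleFactor_eq_ratCombination hd hζ a j (s₀ j) (hratio j)
  refine ⟨fun R => ∏ j, n j (R j), ?_⟩
  rw [fermatLinearCyclePolynomial, Finset.prod_congr rfl fun j _ => hn j, Finset.prod_mul_distrib, ← map_prod,
    Finset.prod_univ_sum]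
  congr 1
  refine Finset.sum_congr rfl fun R _ => ?_
  rw [Finset.prod_congr rfl fun j _ => smul_eq_C_mul _ (n j (R j) : K), Finset.prod_mul_distrib, ← map_prod,
    Finset.prod_mul_distrib, ← map_prod, smul_eq_C_mul, fermatLinearCyclePolynomial, Rat.cast_prod]
  -- the factor of `t ∘ R` at `j` only sees `t_{R j}`
  congr 2

end Product

/-- **Witness-free form.** If every twist `a_j` satisfies (arthcond1) in the form "for all `d`-th roots `x, y` of
`−1` with `T_j(x) ≠ 0`, `T_j(y)/T_j(x) ∈ ℚ`" — which is, twist by twist, the conclusion `hrat` threaded through the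
tree's `Villaflor2022.exists_fakeLinearCycle_of_rational_periods`, and holds trivially (integer ratios) for GENUINE
twists `a_j^d = −1` — then, choosing for each `j` a root `s₀(j) ∈ {ζ, ζ³}` with `T_j(s₀(j)) ≠ 0`
(`Villaflor2022.exists_pairPeriod_ne_zero`), `∏_j Σ_i x_{j,0}^i (a_j x_{j,1})^{d−2−i} = c₀ · Σ_R q_R · ((∏_j t_{R j})·P_{t∘R})`
with `c₀ ∈ K^×` and all `q_R ∈ ℚ`: the polynomial of the (fake) cycle is, up to ONE scalar, a rational combination of
the normalised polynomials of the `d^{#τ}` genuine linear cycles with the same pairing.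
[cite: DuqueFrancoVillaflor2025Join, Remark 7.1] [cite: Villaflorloyola2021, §5 (proof of Theorem 1.2), §6] -/
theorem exists_ratCombination_of_ratio_rational [CharZero K] {τ : Type*} [Fintype τ] [DecidableEq τ] {d : ℕ}
    (hd : 2 ≤ d) {ζ : K} (hζ : IsPrimitiveRoot ζ (2 * d)) (a : τ → K)
    (hratio : ∀ j (x y : K), x ^ d = -1 → y ^ d = -1 → pairPeriod d (a j) x ≠ 0 →
      ∃ q : ℚ, pairPeriod d (a j) y = (q : K) * pairPeriod d (a j) x) :
    ∃ (c₀ : K) (q : (τ → ℕ) → ℚ), c₀ ≠ 0 ∧ fermatLinearCyclePolynomial a (d - 1) =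
      C c₀ * ∑ R ∈ Fintype.piFinset (fun _ : τ => range d), (q R : K) •
        (C (∏ j, ζ ^ (2 * R j + 1)) * fermatLinearCyclePolynomial (fun j => ζ ^ (2 * R j + 1)) (d - 1)) := by
  have hdK : (d : K) ≠ 0 := Nat.cast_ne_zero.mpr (by omega)
  choose s₀ hs₀d hs₀ using fun j => exists_pairPeriod_ne_zero (by omega : 2 ≤ d) hζ (a j)
  obtain ⟨q, hq⟩ := fermatLinearCyclePolynomial_eq_ratCombination hd hζ a s₀
    fun j y hy => hratio j (s₀ j) y (hs₀d j) hy (hs₀ j)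
  exact ⟨_, q, Finset.prod_ne_zero_iff.mpr fun j _ => div_ne_zero (hs₀ j) hdK, hq⟩

/-- **Remark 7.1 for the fake linear cycles of [DuquefrancoVillaflorloyola2023] (`d = 3, 4, 6`).** "By [DuqueVillaflor]
all Fermat varieties of degree `d = 3,4,6` (and only for those degrees) admit fake linear cycles […] every fake linear
cycle is a linear combination of linear cycles `λ = Σ (∏_j n_{j,ℓ_j})·J(p^1_{ℓ_1}, …, p^{n/2+1}_{ℓ_{n/2+1}})`": for twists
`a_j` in the fake-twist set `ζ_{2d}^{−3}·𝕊¹_{ℚ(ζ_d)}` (tree `DuqueFrancoVillaflor2023.IsFakeTwist`, whose periods over the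
`d`-th roots of `−1` have rational ratios by `DuqueFrancoVillaflor2023.fake_pairPeriod_ratio_rational`), the polynomial
`∏_j Σ_i x_{j,0}^i (a_j x_{j,1})^{d−2−i}` (`= P_λ/c_λ`) is `c₀ · Σ_R q_R · ((∏_j t_{R j})·P_{t∘R})` with `c₀ ∈ K^×` and
`q_R ∈ ℚ` — a rational combination, up to one scalar, of the normalised polynomials of the `d^{n/2+1}` genuine linear
cycles `J(p^1_{R 1}, …)` with the same pairing.
[cite: DuqueFrancoVillaflor2025Join, Remark 7.1] [cite: DuquefrancoVillaflorloyola2023, Theorem 1.1]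
[cite: Villaflorloyola2021, §6] -/
theorem fakeLinearCyclePolynomial_eq_ratCombination [CharZero K] {τ : Type*} [Fintype τ] [DecidableEq τ] {d : ℕ}
    (hd : d = 3 ∨ d = 4 ∨ d = 6) {ζ : K} (hζ : IsPrimitiveRoot ζ (2 * d)) (a : τ → K)
    (ha : ∀ j, IsFakeTwist d ζ (a j)) :
    ∃ (c₀ : K) (q : (τ → ℕ) → ℚ), c₀ ≠ 0 ∧ fermatLinearCyclePolynomial a (d - 1) =
      C c₀ * ∑ R ∈ Fintype.piFinset (fun _ : τ => range d), (q R : K) •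
        (C (∏ j, ζ ^ (2 * R j + 1)) * fermatLinearCyclePolynomial (fun j => ζ ^ (2 * R j + 1)) (d - 1)) :=
  exists_ratCombination_of_ratio_rational (by omega) hζ a fun j x y hx hy hne =>
    fake_pairPeriod_ratio_rational hd hζ (ha j) x y hx hy hne

/-- **In the coordinates of `ℙ^{n+1}`** (any pairing `θ : τ ⊕ τ ≃ Fin m` of the variables): the polynomial of the fake
linear cycle `{x_{θ(j,0)} = a_j x_{θ(j,1)}}`, `a_j ∈ ζ_{2d}^{−3}·𝕊¹_{ℚ(ζ_d)}`, `d ∈ {3,4,6}`, is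
`c₀ · Σ_R q_R · linearCyclePoly (d−1) θ (t ∘ R)` with `c₀ ∈ K^×`, `q_R ∈ ℚ` — a rational combination, up to one scalar,
of the tree's normalised linear-cycle polynomials `Villaflor2022.linearCyclePoly` (the polynomials `(∏ c'')·P_δ/c_δ`
over which hypothesis (H2) of `Villaflor2022.exists_fakeLinearCycle_of_rational_periods` quantifies) of the
`d^{#τ}` genuine linear cycles with the same pairing `θ`.
[cite: DuqueFrancoVillaflor2025Join, Remark 7.1] [cite: Villaflorloyola2021, Proposition 5.2, §6] -/
theorem rename_fakeLinearCyclePolynomial_eq_ratCombination [CharZero K] {τ : Type*} [Fintype τ] [DecidableEq τ]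
    {m d : ℕ} (hd : d = 3 ∨ d = 4 ∨ d = 6) {ζ : K} (hζ : IsPrimitiveRoot ζ (2 * d)) (θ : τ ⊕ τ ≃ Fin m)
    (a : τ → K) (ha : ∀ j, IsFakeTwist d ζ (a j)) :
    ∃ (c₀ : K) (q : (τ → ℕ) → ℚ), c₀ ≠ 0 ∧ rename θ (fermatLinearCyclePolynomial a (d - 1)) =
      C c₀ * ∑ R ∈ Fintype.piFinset (fun _ : τ => range d), (q R : K) •
        linearCyclePoly (d - 1) θ (fun j => ζ ^ (2 * R j + 1)) := by
  obtain ⟨c₀, q, hc₀, h⟩ := fakeLinearCyclePolynomial_eq_ratCombination hd hζ a ha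
  refine ⟨c₀, q, hc₀, ?_⟩
  rw [h, map_mul, rename_C, map_sum]
  congr 1
  refine Finset.sum_congr rfl fun R _ => ?_
  rw [map_smul, map_mul, rename_C, linearCyclePoly]

end Literature.AlgebraicGeometry.DuqueFrancoVillaflor2025

end
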